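import Summits.QuantumAdvantage.QuantumAdvantage.Theses.ShorLocallyDark

/-!
# Route `ShorLocallyDark`, support `ControlMarginalFormula` (stmt-QuantumAdvantage-8595)

For `1 < N`, `gcd(a, N) = 1`, any `m`, `S ⊆ Fin m` and control patterns `u, u'`:
`#{y : Fin m → Bool : a^{ofBits(S.piecewise u y)} ≡ a^{ofBits(S.piecewise u' y)} (mod N)}`
`= 2^m · [ord_N(a) ∣ Σ_{j ∈ S} (u_j − u'_j) 2^j]`.
Proof: `a^x ≡ a^{x'} (mod N) ⟺ x ≡ x' (mod ord_N a)` (`a` is a unit modulo `N`; Mathlib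
`pow_eq_pow_iff_modEq` in the unit group), and `x − x' = Σ_{j∈S} (u_j − u'_j) 2^j` does not depend on
`y` (the bits off `S` cancel), so the predicate is constant in `y`.

HONEST FRAMING (block-2b rule): the value here is a closed ledger item (an elementary kernel-checked
lemma), NOT summit progress.

References: M. A. Nielsen, I. L. Chuang, *Quantum Computation and Quantum Information* (2010), §5.3
(the modular-exponentiation register); elementary group theory. [folklore]
-/

set_option linter.dupNamespace false -- D-0017: single-problem summit ⇒ `QuantumAdvantage.QuantumAdvantage` by design

namespace Summit.QuantumAdvantage.QuantumAdvantage.Theorems.ControlMarginalFormula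

open Finset

/-- `ofBits f = Σ_j f_j 2^j`. [folklore] -/
theorem ofBits_eq_sum : ∀ {m : ℕ} (f : Fin m → Bool), (Nat.ofBits f : ℤ) = ∑ j : Fin m, ((f j).toNat : ℤ) * 2 ^ (j : ℕ)
  | 0, f => by simp
  | m + 1, f => by
    rw [Nat.ofBits_succ, Fin.sum_univ_succ]
    simp only [Nat.cast_add, Nat.cast_mul, Nat.cast_ofNat, Fin.val_zero, pow_zero, mul_one, Fin.val_succ,
      pow_succ]
    rw [ofBits_eq_sum (f ∘ Fin.succ), Finset.mul_sum]
    simp only [Function.comp_apply]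
    rw [add_comm]
    congr 1
    exact Finset.sum_congr rfl fun j _ => by ring

/-- The difference of the two exponents does not depend on the free bits `y`. [folklore] -/
theorem ofBits_piecewise_sub {m : ℕ} (S : Finset (Fin m)) (u u' y : Fin m → Bool) :
    (Nat.ofBits (S.piecewise u y) : ℤ) - Nat.ofBits (S.piecewise u' y) =
      ∑ j ∈ S, (((u j).toNat : ℤ) - (u' j).toNat) * 2 ^ (j : ℕ) := by
  classical
  rw [ofBits_eq_sum, ofBits_eq_sum, ← Finset.sum_sub_distrib]
  have h : ∀ j ∈ (Finset.univ : Finset (Fin m)),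
      ((S.piecewise u y j).toNat : ℤ) * 2 ^ (j : ℕ) - ((S.piecewise u' y j).toNat : ℤ) * 2 ^ (j : ℕ) =
        if j ∈ S then (((u j).toNat : ℤ) - (u' j).toNat) * 2 ^ (j : ℕ) else 0 := by
    intro j _
    by_cases hj : j ∈ S
    · rw [Finset.piecewise_eq_of_mem _ _ _ hj, Finset.piecewise_eq_of_mem _ _ _ hj, if_pos hj]; ring
    · rw [Finset.piecewise_eq_of_notMem _ _ _ hj, Finset.piecewise_eq_of_notMem _ _ _ hj, if_neg hj]; ring
  rw [Finset.sum_congr rfl h, Finset.sum_ite_mem, Finset.univ_inter]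

/-- `a^x ≡ a^{x'} (mod N)` iff `ord_N(a) ∣ x − x'`, for `a` coprime to `N`. [folklore] -/
theorem pow_mod_eq_pow_mod_iff {N a : ℕ} (ha : Nat.Coprime a N) (x x' : ℕ) :
    a ^ x % N = a ^ x' % N ↔ ((orderOf (a : ZMod N) : ℤ) ∣ (x : ℤ) - x') := by
  set α : (ZMod N)ˣ := ZMod.unitOfCoprime a ha with hα
  have hαa : (α : ZMod N) = (a : ZMod N) := by rw [hα, ZMod.coe_unitOfCoprime]
  rw [← ZMod.natCast_eq_natCast_iff', Nat.cast_pow, Nat.cast_pow, ← hαa, ← Units.val_pow_eq_pow_val,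
    ← Units.val_pow_eq_pow_val, Units.val_inj, pow_eq_pow_iff_modEq, orderOf_units, Nat.modEq_iff_dvd,
    dvd_sub_comm]

/-- **`ShorLocallyDark.ControlMarginalFormula`** (stmt-QuantumAdvantage-8595). [folklore] -/
theorem controlMarginalFormula_proof :
    Summit.QuantumAdvantage.QuantumAdvantage.Theses.ShorLocallyDark.ControlMarginalFormula := by
  unfold Summit.QuantumAdvantage.QuantumAdvantage.Theses.ShorLocallyDark.ControlMarginalFormula
  intro m N a _ ha S u u'
  classical
  have key : ∀ y : Fin m → Bool,
      (a ^ Nat.ofBits (S.piecewise u y) % N = a ^ Nat.ofBits (S.piecewise u' y) % N) ↔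
        ((orderOf (a : ZMod N) : ℤ) ∣ ∑ j ∈ S, (((u j).toNat : ℤ) - (u' j).toNat) * 2 ^ (j : ℕ)) := by
    intro y
    rw [pow_mod_eq_pow_mod_iff ha, ofBits_piecewise_sub]
  split_ifs with h
  · rw [Finset.filter_true_of_mem fun y _ => (key y).2 h, Finset.card_univ, Fintype.card_fun,
      Fintype.card_bool, Fintype.card_fin]
  · rw [Finset.filter_false_of_mem fun y _ => fun hy => h ((key y).1 hy), Finset.card_empty]

end Summit.QuantumAdvantage.QuantumAdvantage.Theorems.ControlMarginalFormula
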